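import Literature.NumberTheory.LFunctions.Zhang2022.SkeletonPartTwo
import HarnessLib

/-!
# Zhang (2022), Lemma 10.1, part 1/5: the tent `f̃` and `𝔳₁ⱼ(y)` as three Riesz logarithmic means

Topic `Literature/NumberTheory/LFunctions/Zhang2022` (Landau–Siegel audit tree; verdict-neutral).
Y. Zhang, *Discrete mean estimates and the Landau–Siegel zero*, arXiv:2211.02515v1 (2022)
[Zhang2022LandauSiegel] — **an unrefereed manuscript under adjudication**; this file proves one of
its lemmas from the manuscript's own definitions and asserts nothing about its Theorems 1–2.
Cell siegel-zhang (D-0069 width campaign), discharge of DAG node `Z22:Lem10.1` / proof node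
`Z22:Lem10.1.pf` [Z22 pp. 53–54, (10.2)–(10.7), tex L2723–2788], skeleton node
`Skeleton.Lemma101 c′` (`SkeletonPartTwo`), cone C24 of `theorem1_of_leaves`.

Content (proof of Lemma 10.1, the step "(10.6)"): the weight `f̃` of (2.28) is the tent
`f̃(u) = 500((0.504 − u)⁺ − 2(0.502 − u)⁺ + (0.5 − u)⁺)` — the elementary content of the Mellin
formula (10.6) `f̃(log y/log P) = (500/log P)(2πi)⁻¹∫_{(1)}((P₁′)ˢ − 2(P₂′)ˢ + (P₃′)ˢ)y⁻ˢ ds/s²` —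
whence (`frakv1_eq`) `𝔳₁ⱼ(y) = (500/log P)(A(P^{0.504}/y) − 2A(P^{0.502}/y) + A(P^{0.5}/y))` with the
Riesz logarithmic means `A(X) = Σ_{m≤X} χ(m)m^{−1−δ}log(X/m)`, `δ = −β_j` (the tree's
`Lemma82.twist`), which are exactly the sums evaluated by the tree's kernel form of Lemma 8.2
(`Section8Lemma82.sum_twist_log_sub_main_le`).

## References
* Y. Zhang, arXiv:2211.02515v1 (2022), §2 (2.28), §10 Lemma 10.1, (10.6)–(10.7).
  [cite: Zhang2022LandauSiegel, §10 Lemma 10.1]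
-/

noncomputable section

open Complex Real

namespace Literature.NumberTheory.LFunctions.Zhang2022.Lemma101

open Literature.NumberTheory.LFunctions.Zhang2022.Skeleton
open Literature.NumberTheory.LFunctions.Zhang2022.Lemma82 (twist C82)

/-! ### §1. The tent `f̃` as three logarithmic ramps -/

/-- `f̃(u) = 500((0.504 − u)⁺ − 2(0.502 − u)⁺ + (0.5 − u)⁺)`. [cite: Zhang2022LandauSiegel, §2 (2.28); §10 (10.6)] -/
theorem ftilde_eq_ramps (u : ℝ) :
    ftilde u = 500 * (max (0.504 - u) 0 - 2 * max (0.502 - u) 0 + max (0.5 - u) 0) := by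
  unfold ftilde
  split_ifs with h1 h2
  · rw [max_eq_left (by linarith [h1.2]), max_eq_left (by linarith [h1.2]),
      max_eq_right (by linarith [h1.1])]
    ring
  · rw [max_eq_left (by linarith [h2.2]), max_eq_right (by linarith [h2.1]),
      max_eq_right (by linarith [h2.1])]
    ring
  · push Not at h1 h2
    rcases lt_or_ge u 0.5 with h | h
    · rw [max_eq_left (by linarith), max_eq_left (by linarith), max_eq_left (by linarith)]
      ring
    · have h3 : 0.502 < u := h1 h
      have h4 : 0.504 < u := h2 h3.le
      rw [max_eq_right (by linarith), max_eq_right (by linarith), max_eq_right (by linarith)]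
      ring

/-- `0 ≤ f̃ ≤ 1`. [cite: Zhang2022LandauSiegel, §2 (2.28)] -/
theorem ftilde_nonneg (u : ℝ) : 0 ≤ ftilde u := by
  unfold ftilde
  split_ifs with h1 h2
  · linarith [h1.1]
  · linarith [h2.2]
  · exact le_rfl

/-- `f̃ ≤ 1`. [cite: Zhang2022LandauSiegel, §2 (2.28)] -/
theorem ftilde_le_one (u : ℝ) : ftilde u ≤ 1 := by
  unfold ftilde
  split_ifs with h1 h2
  · linarith [h1.2]
  · linarith [h2.1]
  · exact zero_le_one

/-- `f̃(u) = 0` for `u ≤ 0.5`. [cite: Zhang2022LandauSiegel, §2 (2.28)] -/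
theorem ftilde_eq_zero_of_le {u : ℝ} (hu : u ≤ 0.5) : ftilde u = 0 := by
  rw [ftilde_eq_ramps, max_eq_left (by linarith), max_eq_left (by linarith),
    max_eq_left (by linarith)]
  ring

/-- `f̃(u) = 0` for `u ≥ 0.504`. [cite: Zhang2022LandauSiegel, §2 (2.28)] -/
theorem ftilde_eq_zero_of_ge {u : ℝ} (hu : 0.504 ≤ u) : ftilde u = 0 := by
  rw [ftilde_eq_ramps, max_eq_right (by linarith), max_eq_right (by linarith),
    max_eq_right (by linarith)]
  ring

/-- `f̃` is Lipschitz: `|f̃(u) − f̃(v)| ≤ 2000|u − v|`. [cite: Zhang2022LandauSiegel, §2 (2.28)] -/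
theorem abs_ftilde_sub_le (u v : ℝ) : |ftilde u - ftilde v| ≤ 2000 * |u - v| := by
  rw [ftilde_eq_ramps, ftilde_eq_ramps]
  have h : ∀ a : ℝ, |max (a - u) 0 - max (a - v) 0| ≤ |u - v| := by
    intro a
    refine (abs_max_sub_max_le_abs _ _ _).trans (le_of_eq ?_)
    rw [show a - u - (a - v) = -(u - v) by ring, abs_neg]
  have e : 500 * (max (0.504 - u) 0 - 2 * max (0.502 - u) 0 + max (0.5 - u) 0) -
      500 * (max (0.504 - v) 0 - 2 * max (0.502 - v) 0 + max (0.5 - v) 0) =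
      500 * ((max (0.504 - u) 0 - max (0.504 - v) 0) - 2 * (max (0.502 - u) 0 - max (0.502 - v) 0)
        + (max (0.5 - u) 0 - max (0.5 - v) 0)) := by ring
  rw [e, abs_mul, abs_of_pos (by norm_num : (0 : ℝ) < 500)]
  calc 500 * |(max (0.504 - u) 0 - max (0.504 - v) 0) -
          2 * (max (0.502 - u) 0 - max (0.502 - v) 0) + (max (0.5 - u) 0 - max (0.5 - v) 0)|
      ≤ 500 * (|max (0.504 - u) 0 - max (0.504 - v) 0| +
          2 * |max (0.502 - u) 0 - max (0.502 - v) 0| + |max (0.5 - u) 0 - max (0.5 - v) 0|) := by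
        gcongr
        refine (abs_add_le _ _).trans ?_
        gcongr
        refine (abs_sub _ _).trans ?_
        rw [abs_mul, abs_two]
    _ ≤ 500 * (|u - v| + 2 * |u - v| + |u - v|) := by
        have h1 := h 0.504
        have h2 := h 0.502
        have h3 := h 0.5
        nlinarith
    _ = 2000 * |u - v| := by ring

/-- The ramps in logarithmic form: for `P > 1`, `y, m > 0`,
`(a − log(ym)/log P)⁺ = (log(Pᵃ/y/m))⁺/log P`. [cite: Zhang2022LandauSiegel, §10 (10.6)] -/
theorem max_sub_eq_log_ramp {P y m : ℝ} (a : ℝ) (hP : 1 < P) (hy : 0 < y) (hm : 0 < m) :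
    max (a - Real.log (y * m) / Real.log P) 0 =
      max (Real.log (P ^ a / y / m)) 0 / Real.log P := by
  have hlP : 0 < Real.log P := Real.log_pos hP
  have hP0 : 0 < P := by linarith
  rw [← max_div_div_right hlP.le, zero_div, Real.log_div (by positivity) hm.ne',
    Real.log_div (by positivity) hy.ne', Real.log_rpow hP0, Real.log_mul hy.ne' hm.ne']
  congr 1
  field_simp
  ring

/-- **(10.6) in elementary form**: `f̃(log(ym)/log P) = (500/log P)·((log(P^{0.504}/(ym)))⁺
− 2(log(P^{0.502}/(ym)))⁺ + (log(P^{0.5}/(ym)))⁺)`. [cite: Zhang2022LandauSiegel, §10 (10.6)] -/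
theorem ftilde_log_eq {P y m : ℝ} (hP : 1 < P) (hy : 0 < y) (hm : 0 < m) :
    ftilde (Real.log (y * m) / Real.log P) = 500 / Real.log P *
      (max (Real.log (P ^ (0.504 : ℝ) / y / m)) 0 - 2 * max (Real.log (P ^ (0.502 : ℝ) / y / m)) 0
        + max (Real.log (P ^ (0.5 : ℝ) / y / m)) 0) := by
  have hlP : 0 < Real.log P := Real.log_pos hP
  rw [ftilde_eq_ramps, max_sub_eq_log_ramp _ hP hy hm, max_sub_eq_log_ramp _ hP hy hm,
    max_sub_eq_log_ramp _ hP hy hm]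
  field_simp

/-! ### §2. From the `f̃`-weighted sum to three Riesz logarithmic means -/

variable {D : ℕ} (χ : DirichletCharacter ℂ D)

/-- The ramp-weighted sum over `1 ≤ m < Q` is the Riesz logarithmic mean over `m ≤ X`, provided
`0 < X ≤ Q`. [cite: Zhang2022LandauSiegel, §10 proof of Lemma 10.1] -/
theorem sum_ramp_eq (δ : ℂ) {X : ℝ} {Q : ℕ} (hX : 0 < X) (hXQ : X ≤ Q) :
    ∑ m ∈ Finset.Ico 1 Q, twist χ δ m * ((max (Real.log (X / m)) 0 : ℝ) : ℂ) =
      ∑ m ∈ Finset.Ioc 0 ⌊X⌋₊, twist χ δ m * (Real.log (X / m) : ℂ) := by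
  classical
  set g : ℕ → ℂ := fun m => twist χ δ m * ((max (Real.log (X / m)) 0 : ℝ) : ℂ) with hg
  have hS1 : ∑ m ∈ Finset.Ico 1 Q, g m = ∑ m ∈ Finset.Ioc 0 ⌊X⌋₊ ∪ Finset.Ico 1 Q, g m := by
    refine Finset.sum_subset Finset.subset_union_right fun m hm hm' => ?_
    rw [Finset.mem_union] at hm
    have hm1 : m ∈ Finset.Ioc 0 ⌊X⌋₊ := hm.resolve_right hm'
    rw [Finset.mem_Ioc] at hm1
    have hQm : Q ≤ m := by
      by_contra h
      exact hm' (Finset.mem_Ico.mpr ⟨hm1.1, not_le.mp h⟩)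
    have h1 : (m : ℝ) ≤ X := (Nat.cast_le.mpr hm1.2).trans (Nat.floor_le hX.le)
    have h2 : X ≤ m := hXQ.trans (Nat.cast_le.mpr hQm)
    have hmX : (m : ℝ) = X := le_antisymm h1 h2
    have : Real.log (X / m) = 0 := by rw [hmX, div_self hX.ne', Real.log_one]
    simp [hg, this]
  have hS2 : ∑ m ∈ Finset.Ioc 0 ⌊X⌋₊, twist χ δ m * (Real.log (X / m) : ℂ) =
      ∑ m ∈ Finset.Ioc 0 ⌊X⌋₊ ∪ Finset.Ico 1 Q, g m := by
    rw [← Finset.sum_subset Finset.subset_union_left]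
    · refine Finset.sum_congr rfl fun m hm => ?_
      rw [Finset.mem_Ioc] at hm
      have hm0 : (0 : ℝ) < m := by exact_mod_cast hm.1
      have hmX : (m : ℝ) ≤ X := (Nat.cast_le.mpr hm.2).trans (Nat.floor_le hX.le)
      have : 0 ≤ Real.log (X / m) := Real.log_nonneg ((one_le_div hm0).mpr hmX)
      simp only [hg, max_eq_left this]
    · intro m hm hm'
      rw [Finset.mem_union] at hm
      have hm1 : m ∈ Finset.Ico 1 Q := hm.resolve_left hm'
      rw [Finset.mem_Ico] at hm1
      have hm0 : (0 : ℝ) < m := by exact_mod_cast hm1.1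
      have hXm : X < m := by
        refine Nat.lt_of_floor_lt (not_le.mp fun h => hm' ?_)
        exact Finset.mem_Ioc.mpr ⟨hm1.1, h⟩
      have : Real.log (X / m) ≤ 0 :=
        Real.log_nonpos (by positivity) ((div_le_one hm0).mpr hXm.le)
      simp [hg, max_eq_right this]
  rw [hS2, ← hS1]

/-- **`𝔳₁ⱼ(y)` as three Riesz logarithmic means** (`δ = −β_j`): for `y ≥ 1` and `P > 1`,
`𝔳₁ⱼ(y) = (500/log P)·(A(P^{0.504}/y) − 2A(P^{0.502}/y) + A(P^{0.5}/y))`,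
`A(X) = Σ_{m≤X} χ(m)m^{−1−δ}log(X/m)`. [cite: Zhang2022LandauSiegel, §10 (10.6)–(10.7)] -/
theorem frakv1_eq (c' : ℝ) (j : ℕ) {y : ℝ} (hy : 1 ≤ y) (hP : 1 < bigP D) :
    frakv1 c' χ j y = ((500 / Real.log (bigP D) : ℝ) : ℂ) *
      ((∑ m ∈ Finset.Ioc 0 ⌊bigP D ^ (0.504 : ℝ) / y⌋₊, twist χ (-betaJ c' D j) m *
          (Real.log (bigP D ^ (0.504 : ℝ) / y / m) : ℂ)) -
        2 * (∑ m ∈ Finset.Ioc 0 ⌊bigP D ^ (0.502 : ℝ) / y⌋₊, twist χ (-betaJ c' D j) m *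
          (Real.log (bigP D ^ (0.502 : ℝ) / y / m) : ℂ)) +
        (∑ m ∈ Finset.Ioc 0 ⌊bigP D ^ (0.5 : ℝ) / y⌋₊, twist χ (-betaJ c' D j) m *
          (Real.log (bigP D ^ (0.5 : ℝ) / y / m) : ℂ))) := by
  have hy0 : 0 < y := by linarith
  have hP0 : 0 < bigP D := by linarith
  set P : ℝ := bigP D with hPdef
  set β : ℂ := betaJ c' D j with hβ
  -- `X_a = P^a/y` satisfies `0 < X_a ≤ ⌈P⌉₊` for `a ≤ 1`
  have hXpos : ∀ a : ℝ, 0 < P ^ a / y := fun a => by positivity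
  have hXQ : ∀ a : ℝ, a ≤ 1 → P ^ a / y ≤ (⌈P⌉₊ : ℕ) := by
    intro a ha
    calc P ^ a / y ≤ P ^ a := div_le_self (by positivity) hy
      _ ≤ P ^ (1 : ℝ) := Real.rpow_le_rpow_of_exponent_le hP.le ha
      _ = P := Real.rpow_one P
      _ ≤ (⌈P⌉₊ : ℕ) := Nat.le_ceil P
  -- rewrite each summand
  have hterm : ∀ m ∈ Finset.Ico 1 ⌈P⌉₊,
      χ (m : ZMod D) * (ftilde (Real.log (y * m) / Real.log P) : ℂ) / (m : ℂ) ^ (1 - β) =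
        ((500 / Real.log P : ℝ) : ℂ) *
          (twist χ (-β) m * ((max (Real.log (P ^ (0.504 : ℝ) / y / m)) 0 : ℝ) : ℂ) -
            2 * (twist χ (-β) m * ((max (Real.log (P ^ (0.502 : ℝ) / y / m)) 0 : ℝ) : ℂ)) +
            twist χ (-β) m * ((max (Real.log (P ^ (0.5 : ℝ) / y / m)) 0 : ℝ) : ℂ)) := by
    intro m hm
    rw [Finset.mem_Ico] at hm
    have hm0 : (0 : ℝ) < m := by exact_mod_cast hm.1
    rw [ftilde_log_eq hP hy0 hm0, div_eq_mul_inv, ← Complex.cpow_neg,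
      show -(1 - β) = -1 - -β by ring, twist]
    push_cast
    ring
  rw [frakv1, Finset.sum_congr rfl hterm, ← Finset.mul_sum, Finset.sum_add_distrib,
    Finset.sum_sub_distrib, ← Finset.mul_sum,
    sum_ramp_eq χ (-β) (hXpos _) (hXQ _ (by norm_num)),
    sum_ramp_eq χ (-β) (hXpos _) (hXQ _ (by norm_num)),
    sum_ramp_eq χ (-β) (hXpos _) (hXQ _ (by norm_num))]

end Literature.NumberTheory.LFunctions.Zhang2022.Lemma101
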